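import Summits.BirchSwinnertonDyer.Rank1Residual.Additive.X3BranchKummerLineClasses
import Summits.BirchSwinnertonDyer.Rank1Residual.Additive.X3BranchResidualCountOfCharacterFacts
import Summits.BirchSwinnertonDyer.Rank1Residual.X2.ResidualLineCharacters
import Literature.Barriers.ABC.BakerMethodBoundsPrimeLogFormsProofs
import HarnessLib

/-!
# X3, the DEGENERATE rows: the quotient `Ψ = W[p]/Φ₀` of the TRIVIAL line is an `ω`-line;
# independence of `Σ₀`-units modulo `p`-th powers; combination of Kummer relations
# (cell `bsd-eis`, seat `bsd-eis-x3` gen 6; sequel of `X3BranchKummerLineClasses.lean`, inputs of the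
# U-side LOWER BOUND of the degenerate certificate road; route K1 `AdditiveBranchIMC`, crux
# `GordTwoRankZeroOffCaseOne` — supports only)

HONEST FRAMING (cell `bsd-eis`, `run/shared/lean/pub/bsd-eis/README.md` §4): the programme's target of
record is the full Birch–Swinnerton-Dyer formula for every `E/ℚ` of analytic rank `≤ 1`; this file
serves the DEGENERATE X3 rows (rational line `Φ₀` with TRIVIAL `Γ_ℚ`-action). THEOREMS ONLY (no
`def`, no named fact, no `sorry`); nothing is booked; no label, tier or count of record moves.

* §1 `quot_smul_eq_cyclotomic_of_trivialLine` — on `Ψ = W[p]/Φ₀` (X2 vocabulary `(lineSub Φ₀ hΦ).Quot`,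
  definitionally GV's `(residualLine Φ₀ hΦ).Quot`) every `σ ∈ Γ_ℚ` acts as the scalar `χ_p(σ)`:
  `φψ = ω` with `φ = 1` (the Weil pairing, tree `X3Branch.natCast_mul_eq_modNCyclotomicCharacter_of_line`);
  `exists_generator_quot` — a generator `y₀` of order `p`.
* §2 `eq_zero_of_pow_eq_prod` — if `a_j ∈ ℕ` is divisible exactly once by
  its prime `ℓ_j` and not by the other `ℓ_i`, then `r^p = ∏ a_i^{d_i}` (`r ∈ ℚ`, `d_i ∈ 𝔽_p`) forces
  `d = 0`; `rel_sum` — Kummer relations `σβ_i = ζ^nβ_i ∧ f_i(σ) = n·y₀` combine to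
  `∏ β_i^{k_i}`, `Σ k_i f_i`.

References: [GreenbergVatsal2000] §2 p. 28; [SerreLocalFields1979] Ch. X §3.
-/

set_option autoImplicit false

noncomputable section

open scoped Classical AddSubgroup

namespace Summit.BirchSwinnertonDyer.Rank1Residual.Additive

namespace KummerLineClasses

open NumberField IsDedekindDomain Field WeierstrassCurve
  Literature.NumberTheory.GaloisRepresentations
  Literature.NumberTheory.EllipticCurves
  Literature.NumberTheory.EllipticCurves.GreenbergSelmer
  Literature.NumberTheory.EllipticCurves.GreenbergVatsal2000
  Literature.NumberTheory.EllipticCurves.Rank1Residual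
  Summit.BirchSwinnertonDyer.Rank1Residual.X2.ResidualDevissageModules
  Summit.BirchSwinnertonDyer.Rank1Residual.X2.ResidualDevissageLine
  Summit.BirchSwinnertonDyer.Rank1Residual.X2.ResidualLineCharacters
  Summit.BirchSwinnertonDyer.Rank1Residual.X2.PrimeOrderCharacters

variable {p : ℕ} [hp : Fact p.Prime] {W : WeierstrassCurve ℚ} [W.IsElliptic]
  {Φ₀ : AddSubgroup (geomTorsion W (p : ℤ))}

/-! ### §1 The quotient `Ψ = W[p]/Φ₀` of the TRIVIAL line is an `ω`-line -/

/-- **`Ψ = W[p]/Φ₀` carries the mod-`p` cyclotomic character when `Φ₀` is the trivial line**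
(`φψ = ω`, GV p. 28, with `φ = 1`; the Weil pairing, tree
`X3Branch.natCast_mul_eq_modNCyclotomicCharacter_of_line`). [cite: GreenbergVatsal2000, §2 p. 28] -/
theorem quot_smul_eq_cyclotomic_of_trivialLine [NeZero ((p : ℕ) : ℚ)] (hΦ : IsRationalLine W p Φ₀)
    (htriv : ∀ (σ : absoluteGaloisGroup ℚ) (P : geomTorsion W (p : ℤ)), P ∈ Φ₀ → σ • P = P)
    (σ : absoluteGaloisGroup ℚ) (y : (lineSub Φ₀ hΦ).Quot) :
    σ • y = ((modNCyclotomicCharacter ℚ p σ : (ZMod p)ˣ) : ZMod p).val • y := by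
  haveI : NeZero p := ⟨hp.out.ne_zero⟩
  obtain ⟨χ, hχ⟩ := exists_character_of_natCard_eq (G := absoluteGaloisGroup ℚ) (natCard_quot_eq hΦ)
  have hb : ∀ P : geomTorsion W (p : ℤ), σ • P - ((χ σ : ZMod p).val) • P ∈ Φ₀ :=
    smul_sub_nsmul_mem_of_quot hΦ (fun y ↦ hχ σ y)
  have ha : ∀ P ∈ Φ₀, σ • P = (1 : ℕ) • P := fun P hP ↦ by rw [one_smul]; exact htriv σ P hP
  have key := X3Branch.natCast_mul_eq_modNCyclotomicCharacter_of_line hΦ ha hb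
  rw [Nat.cast_one, one_mul, ZMod.natCast_zmod_val] at key
  rw [hχ σ y, key]

/-- `Ψ` has an element of additive order `p`, and every element is a multiple of it. -/
theorem exists_generator_quot (hΦ : IsRationalLine W p Φ₀) :
    ∃ y₀ : (lineSub Φ₀ hΦ).Quot, addOrderOf y₀ = p ∧ ∀ y : (lineSub Φ₀ hΦ).Quot, ∃ t : ℕ, y = t • y₀ := by
  have hcard := natCard_quot_eq hΦ
  haveI : Finite (lineSub Φ₀ hΦ).Quot := Nat.finite_of_card_ne_zero (by rw [hcard]; exact hp.out.ne_zero)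
  haveI : IsAddCyclic (lineSub Φ₀ hΦ).Quot := isAddCyclic_of_prime_card hcard
  obtain ⟨g, hg⟩ := IsAddCyclic.exists_generator (α := (lineSub Φ₀ hΦ).Quot)
  have hord : addOrderOf g = p := by rw [addOrderOf_eq_card_of_forall_mem_zmultiples hg, hcard]
  refine ⟨g, hord, fun y ↦ ?_⟩
  obtain ⟨k, -, hk⟩ := Finset.mem_image.mp (mem_zmultiples_iff_mem_range_addOrderOf.mp (hg y))
  exact ⟨k, hk.symm⟩

/-! ### §2 Arithmetic independence of the `Σ₀`-units and the combination of Kummer relations -/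

/-- **Independence of the `Σ₀`-units modulo `p`-th powers.** If each `a_j ∈ ℕ` is divisible
exactly once by "its" prime `ℓ_j` and not at all by the other `ℓ_i`, then
`r^p = ∏ a_i^{d_i}` with `r ∈ ℚ`, `d_i < p`, forces every `d_i = 0` (`ℓ_j`-adic valuations).
[folklore] -/
theorem eq_zero_of_pow_eq_prod {ι : Type*} [Fintype ι] (a ℓ : ι → ℕ) (hℓ : ∀ i, (ℓ i).Prime)
    (hval : ∀ i j, padicValNat (ℓ i) (a j) = if i = j then 1 else 0) (ha : ∀ i, a i ≠ 0)
    (d : ι → ZMod p) (r : ℚ) (hr : r ^ p = ∏ i, (a i : ℚ) ^ (d i).val) : d = 0 := by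
  funext j
  haveI := Fact.mk (hℓ j)
  have hprod0 : (∏ i, (a i : ℚ) ^ (d i).val) ≠ 0 :=
    Finset.prod_ne_zero_iff.mpr fun i _ ↦ pow_ne_zero _ (Nat.cast_ne_zero.mpr (ha i))
  have hr0 : r ≠ 0 := by
    rintro rfl
    rw [zero_pow hp.out.ne_zero] at hr
    exact hprod0 hr.symm
  have h1 : padicValRat (ℓ j) (r ^ p) = (p : ℤ) * padicValRat (ℓ j) r := padicValRat.pow r
  have h2 : padicValRat (ℓ j) (∏ i, (a i : ℚ) ^ (d i).val) = ((d j).val : ℤ) := by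
    rw [Literature.Barriers.ABC.padicValRat_finset_prod _ _
      fun i _ ↦ pow_ne_zero _ (Nat.cast_ne_zero.mpr (ha i))]
    simp_rw [padicValRat.pow, padicValRat.of_nat, hval j]
    simp
  rw [hr] at h1
  rw [h1] at h2
  -- `p ∣ d_j < p`
  have hdvd : (p : ℤ) ∣ ((d j).val : ℤ) := ⟨_, h2.symm⟩
  have hlt := (d j).val_lt
  have hzero : (d j).val = 0 := by
    have := Int.natCast_dvd_natCast.mp hdvd
    exact Nat.eq_zero_of_dvd_of_lt this hlt
  exact (ZMod.val_eq_zero _).mp hzero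

variable {Ψ : Type} [AddCommGroup Ψ] [DistribMulAction (absoluteGaloisGroup ℚ) Ψ]

omit hp [W.IsElliptic] [DistribMulAction (absoluteGaloisGroup ℚ) Ψ] in
/-- **Kummer relations combine**: if `σβ_i = ζ^{n}β_i ∧ f_i(σ) = n·y₀` for each `i`, then the same
relation holds for `∏ β_i^{k_i}` and `Σ k_i f_i`. [folklore] -/
theorem rel_sum {ι : Type*} (s : Finset ι) {ζ : AlgebraicClosure ℚ} (y₀ : Ψ)
    (β : ι → AlgebraicClosure ℚ) (f : ι → absoluteGaloisGroup ℚ → Ψ)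
    (hrel : ∀ i σ, ∃ n : ℕ, σ • β i = ζ ^ n * β i ∧ f i σ = n • y₀) (k : ι → ℕ)
    (σ : absoluteGaloisGroup ℚ) :
    ∃ n : ℕ, σ • (∏ i ∈ s, β i ^ k i) = ζ ^ n * ∏ i ∈ s, β i ^ k i ∧
      (∑ i ∈ s, k i • f i σ) = n • y₀ := by
  induction s using Finset.cons_induction with
  | empty => exact ⟨0, by simp, by simp⟩
  | cons a s ha ih =>
    obtain ⟨m, hm1, hm2⟩ := ih
    obtain ⟨n, hn1, hn2⟩ := hrel a σ
    refine ⟨k a * n + m, ?_, ?_⟩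
    · rw [Finset.prod_cons, smul_mul', smul_pow', hn1, hm1, mul_pow, ← pow_mul, pow_add]
      ring
    · rw [Finset.sum_cons, hn2, hm2, add_nsmul, mul_nsmul']

end KummerLineClasses

end Summit.BirchSwinnertonDyer.Rank1Residual.Additive
end
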